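import Summits.AtomisticToContinuum.HydrodynamicLimit.Theses.SuperextensiveClosureCost
import Literature.Analysis.FluidPDE.CollisionalTransferFunctional

/-!
# Birth skeleton (BC3) — crux `MomentumClosureCost` (stmt-AtomisticToContinuum-14424)

route-AtomisticToContinuum-SuperextensiveClosureCost (sub-problem HydrodynamicLimit), crux #2 (rank 2):
under the INVARIANT homogeneous hard-sphere Gibbs law `G_N = localGibbsLaw σ 1 0 θe N (Φ N)` the
trajectory event "speed cap `(N+1)^{1/24}` and ball-packing cap `ρ^{(ℓ)}σ³ ≤ η₁` hold on `[s,s+τ]`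
AND the time-integrated weak-form Euler momentum-closure defect `D_N` of the smooth test field `ψ`
exceeds `δ`" has `G_N`-probability `≤ exp(−M(N+1))` eventually, for every `M`.

LINE `birth` = the PHYSICAL SPLITTING OF THE DEFECT FUNCTIONAL along the three closures hidden in
the Euler momentum flux `ρu⊗u + p𝟙` (Spohn 1991 Part I (3.7): microscopic momentum current =
kinetic part `Σ v_i⊗v_i δ(q_i−x)` + collisional transfer; `p = ρθ·Z(ρσ³)` = kinetic `ρθ` + excess
`ρθ(Z−1)`), each a NAMED functional of the orbit defined below:

  `D_N = T_N + K_N + V_N`   (definitionally: `transportResidual := eulerDefect − anisotropyDefect − virialDefect`)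

* `K_N = anisotropyDefect`  — `∫_s^{s+τ}∫ ∂_iψ_j · (S^{(ℓ)}_{ij} − m_im_j/ρ − δ_{ij} ρθ)`, the work of
  `∇ψ` against the TRACELESS ANISOTROPIC part of the ball-averaged empirical kinetic stress
  `S^{(ℓ)}_{ij}(r,x) = (N+1)⁻¹Σ_k χ_ℓ(x,q_k) v_{k,i}v_{k,j}` (new object `blockStress`; its trace is
  `2e^{(ℓ)}` identically, so only anisotropy is priced);
* `V_N = virialDefect`      — exact pair-form COLLISIONAL MOMENTUM TRANSFER against `ψ(t_c,·)`
  over the collisions in `(s,s+τ]` (per particle) minus the excess-pressure work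
  `∫∫ (p − ρθ) div ψ` of the block fields (virial / contact-value closure `Z(ρσ³) − 1`);
* `T_N = transportResidual` — what is left: on good orbits, where every integrand is integrable, the
  exact microscopic momentum balance for time-dependent test fields (time-sliced form of the landed
  `HardSphereFlow.momentumObservable_sub_eq_torus'`) reduces it to the pure BLOCK-SMOOTHING error
  `∫ [(N+1)⁻¹Σ_k ⟨Dψ(r,q_k)v_k,v_k⟩ − ∫_x ∇ψ(r,x):S^{(ℓ)}(r,x)] dr = O(ℓ_N ‖D²ψ‖_∞ · max_k|v_k|²)
  = O(N^{-1/6})` under the speed cap — deterministic.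

Registered stubs (the ONLY `sorry`s of the file):
* `stub_balanceOnBlockStress` · `BalanceOnBlockStress` — deterministic: eventually in `N`, for every
  GOOD datum obeying the speed cap on `[s,s+τ]`, `|T_N| ≤ δ` (size L: time-dependent balance law,
  integrability of the block functionals along piecewise-free orbits, smoothing estimate);
* `stub_kineticIsotropyCost` · `KineticIsotropyCost` — LD, HARDEST / load-bearing:
  `G_N(caps ∧ δ < |K_N|) ≤ e^{−M(N+1)}` eventually, ∀ M (sustained anisotropic block stress in the
  dilute equilibrium flow is superexponentially rare);
* `stub_virialClosureCost` · `VirialClosureCost` — LD: `G_N(caps ∧ δ < |V_N|) ≤ e^{−M(N+1)}`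
  eventually, ∀ M (sustained anomalous contact statistics are superexponentially rare; the known
  floor, collisionless lanes at `Θ(N log N)`, lives here and is still superexponential).
* `MomentumClosureCost_of_stubs : BalanceOnBlockStress → KineticIsotropyCost → VirialClosureCost →
  CruxStatement` (`CruxStatement := MomentumClosureCost`, `Iff.rfl`) — REAL PROOF (no sorry;
  `MomentumClosureCost_of : MomentumClosureCost`, its instance at the three `stub_*`, is the registered
  crux-headed theorem — the only theorem of the file whose syntactic head is the crux): `η₁ := min`, `σ₀ := min`, the three eventualities at
  `δ/3` and `M+1`; pathwise `|D| ≤ |T| + |K| + |V|` on good data, `G_N(goodᶜ) = 0`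
  (`localGibbsLaw = liouville.withDensity _`, `HardSphereFlow.measure_compl_good`), union bound,
  `2e^{−(M+1)(N+1)} ≤ e^{−M(N+1)}`; the crux's let-bound event is these functionals by `rfl`.

Suspect-false evidence honoured (refuter rreview1, SUSPECT-FALSE-14424.md, 2026-08-16; no
`Disproof.lean` on file for this crux): the "vacuum-gap needle beam" witness has NO collisions in the
beam slab (`V_N ≈ 0`, excess pressure of the tenuous beams `→ 0`), exact transport (`T_N → 0`), and
its whole defect `D_N = p_Z τ` is the anisotropy term `K_N` (bimodal `±U e₁` beams: `S_22 = 0` vs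
inferred `ρθ = ρ_Z U²/3`).  So the witness, if confirmed, falsifies exactly `stub_kineticIsotropyCost`
(and the crux with it); the proposed repair C′ (4th-moment cap added to the conditioning event) is a
one-conjunct change of `SpeedCapped` shared by the two LD stubs — the splitting is repair-stable.
Negatives index: none of 9168/9236/9238 (finite-instance Enskog families, warm/cold dichotomies) is
restated by a stub (all three stubs are `N → ∞` statements about the true flow / a sure smoothing
lemma).
-/

namespace Summit.AtomisticToContinuum.HydrodynamicLimit.Cruxes.MomentumClosureCost.Birth

noncomputable section

open scoped BigOperators Topology Manifold Classical MeasureTheory ProbabilityTheory Matrix InnerProductSpace ComplexConjugate ContinuousMap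
open Filter Set Function TopologicalSpace MeasureTheory
open Literature.MathematicalPhysics.KineticTheory (T3 V3 hsDiameter hsPressure localGibbsLaw
  empiricalDensityField empiricalMomentumField empiricalEnergyField)
open Literature.Analysis.FluidPDE (HardSphereFlow Config empiricalMeasure collisionTimes collidingPairs)

/-! ## The objects of the line (all explicit; the crux's `let`-bindings, named) -/

/-- The route's flow type: `N+1` hard spheres of diameter `hsDiameter σ N = σ(N+1)^{-1/3}` on `𝕋³`. -/
abbrev Flow (σ : ℝ) (N : ℕ) :=
  HardSphereFlow (Literature.Analysis.FluidPDE.Torus.geometry (Fin 3)) (hsDiameter σ N) (N + 1)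

/-- Phase space of `N+1` spheres on `𝕋³`. -/
abbrev Phase (N : ℕ) := Config (N + 1) (Fin 3) T3

/-- Block radius `ℓ_N = (N+1)^{-1/4}` (the crux's `ℓ`). -/
def ballRadius (N : ℕ) : ℝ := ((N + 1 : ℕ) : ℝ) ^ (-(1 / 4 : ℝ))

/-- Normalised ball kernel `χ_ℓ(x,y) = 𝟙{dist(x,y) < ℓ_N} / |B_ℓ|` (the crux's `χ`). -/
def ballKernel (N : ℕ) (x y : T3) : ℝ :=
  if Literature.Analysis.FluidPDE.Torus.euclidDist x y < ballRadius N then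
    (4 / 3 * Real.pi * ballRadius N ^ 3)⁻¹ else 0

variable {σ : ℝ} {N : ℕ}

/-- Ball-averaged empirical density `ρ^{(ℓ)}(r,x)` along the orbit of `z` (the crux's `ρ`). -/
def blockDensity (Φ : Flow σ N) (z : Phase N) (r : ℝ) (x : T3) : ℝ :=
  empiricalDensityField (Φ.flow r z) (ballKernel N x)

/-- Ball-averaged empirical momentum `m^{(ℓ)}(r,x)` (the crux's `m`). -/
def blockMomentum (Φ : Flow σ N) (z : Phase N) (r : ℝ) (x : T3) : V3 :=
  empiricalMomentumField (Φ.flow r z) (ballKernel N x)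

/-- Ball-averaged empirical kinetic energy `e^{(ℓ)}(r,x)` (the crux's `e`). -/
def blockEnergy (Φ : Flow σ N) (z : Phase N) (r : ℝ) (x : T3) : ℝ :=
  empiricalEnergyField (Φ.flow r z) (ballKernel N x)

/-- Kinetic block temperature `θ^{(ℓ)} = (2/3)(e/ρ − |m|²/(2ρ²))` (the crux's inlined `θ`;
junk `0/0 = 0` on empty balls, where every block functional below vanishes). -/
def blockTemperature (Φ : Flow σ N) (z : Phase N) (r : ℝ) (x : T3) : ℝ :=
  2 / 3 * (blockEnergy Φ z r x / blockDensity Φ z r x -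
    ‖blockMomentum Φ z r x‖ ^ 2 / (2 * blockDensity Φ z r x ^ 2))

/-- Block EOS pressure `p^{(ℓ)} = hsPressure σ ρ^{(ℓ)} θ^{(ℓ)} = ρθ·Z(ρσ³)` (the crux's `p`). -/
def blockPressure (Φ : Flow σ N) (z : Phase N) (r : ℝ) (x : T3) : ℝ :=
  hsPressure σ (blockDensity Φ z r x) (blockTemperature Φ z r x)

/-- **New object of the line: the ball-averaged empirical KINETIC STRESS tensor**
`S^{(ℓ)}_{ij}(r,x) = (N+1)⁻¹ Σ_k χ_ℓ(x,q_k(r)) v_{k,i}(r) v_{k,j}(r)` (second velocity moments of the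
block; Spohn 1991 (3.7), kinetic part of the momentum current, mollified at scale `ℓ_N`). -/
def blockStress (Φ : Flow σ N) (z : Phase N) (r : ℝ) (x : T3) (i j : Fin 3) : ℝ :=
  ∫ y, ballKernel N x y.1 * (y.2 i * y.2 j) ∂(empiricalMeasure (Φ.flow r z))

/-- Raw empirical momentum paired with a vector test field, `⟨g, m_N(r)⟩` (the crux's `Mt`). -/
def momentumPairing (Φ : Flow σ N) (z : Phase N) (r : ℝ) (g : T3 → V3) : ℝ :=
  ∑ j, (empiricalMomentumField (Φ.flow r z) (fun y => g y j)) j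

/-- The speed cap on `[s,s+τ]`: every speed `≤ (N+1)^{1/24}` (first conjunct of the crux's event). -/
def SpeedCapped (Φ : Flow σ N) (s τ : ℝ) (z : Phase N) : Prop :=
  ∀ r ∈ Set.Icc s (s + τ), ∀ i, ‖(Φ.flow r z i).2‖ ≤ ((N + 1 : ℕ) : ℝ) ^ (1 / 24 : ℝ)

/-- The ball-packing cap on `[s,s+τ]`: `ρ^{(ℓ)}(r,x)σ³ ≤ η₁` (second conjunct of the crux's event). -/
def PackingCapped (η₁ : ℝ) (Φ : Flow σ N) (s τ : ℝ) (z : Phase N) : Prop :=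
  ∀ r ∈ Set.Icc s (s + τ), ∀ x, blockDensity Φ z r x * σ ^ 3 ≤ η₁

/-- **The crux's defect functional** `D_N(z)`: boundary terms minus the time integral of
`⟨∂_rψ, m_N⟩ + ∫ (Σ_ij ∂_iψ_j m_im_j/ρ + p div ψ)` on block fields (third conjunct of the event,
verbatim with the `let`s named). -/
def eulerDefect (Φ : Flow σ N) (s τ : ℝ) (ψ : ℝ → T3 → V3) (z : Phase N) : ℝ :=
  momentumPairing Φ z (s + τ) (ψ (s + τ)) - momentumPairing Φ z s (ψ s) -
    ∫ r in s..(s + τ), (momentumPairing Φ z r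
        (Literature.Analysis.FunctionSpaces.Torus.timeDerivWithin (Set.Icc s (s + τ)) ψ r) +
      ∫ x, ((∑ i, ∑ j, (Literature.Analysis.FunctionSpaces.Torus.partialDeriv i (ψ r) x) j *
          (blockMomentum Φ z r x i * blockMomentum Φ z r x j / blockDensity Φ z r x)) +
        blockPressure Φ z r x * Literature.Analysis.FunctionSpaces.Torus.divergence (ψ r) x))

/-- **Piece K — kinetic anisotropy work**: `∫_s^{s+τ} ∫ Σ_ij ∂_iψ_j (S^{(ℓ)}_{ij} − m_im_j/ρ − δ_ij ρθ)`.
The bracket is the traceless non-Maxwellian part of the block kinetic stress (its trace vanishes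
identically: `Σ_i S_ii = 2e = |m|²/ρ + 3ρθ`). -/
def anisotropyDefect (Φ : Flow σ N) (s τ : ℝ) (ψ : ℝ → T3 → V3) (z : Phase N) : ℝ :=
  ∫ r in s..(s + τ), ∫ x, ∑ i, ∑ j,
    (Literature.Analysis.FunctionSpaces.Torus.partialDeriv i (ψ r) x) j *
      (blockStress Φ z r x i j
        - blockMomentum Φ z r x i * blockMomentum Φ z r x j / blockDensity Φ z r x
        - (if i = j then blockDensity Φ z r x * blockTemperature Φ z r x else 0))

/-- **Collisional momentum transfer against the time-dependent field `ψ`** over the collisions of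
the orbit in `(s, s+τ]`, per particle: `(N+1)⁻¹ Σ_{t_c} Σ_{(i,j) colliding} ⟪ψ(t_c, q_i), v_i⁺ − v_i⁻⟫`
(pair form, each particle of the pair once — the kernel of
`Literature.Analysis.FluidPDE.collisionalMomentumTransfer`, evaluated with the slice `ψ t_c`;
a `finsum`, an honest finite sum on good orbits). -/
def collisionalWork (Φ : Flow σ N) (s τ : ℝ) (ψ : ℝ → T3 → V3) (z : Phase N) : ℝ :=
  ((N + 1 : ℕ) : ℝ)⁻¹ *
    ∑ᶠ t ∈ collisionTimes (Literature.Analysis.FluidPDE.Torus.geometry (Fin 3)) (hsDiameter σ N)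
        (fun r => Φ.flow r z) ∩ Set.Ioc s (s + τ),
      ∑ p ∈ collidingPairs (Literature.Analysis.FluidPDE.Torus.geometry (Fin 3)) (hsDiameter σ N)
          (Φ.flow t z),
        ⟪ψ t (Φ.flow t z p.1).1, (Φ.flow t z p.1).2 - (Function.leftLim (fun r => Φ.flow r z) t p.1).2⟫_ℝ

/-- **Piece V — virial (excess-pressure) closure defect**: collisional momentum transfer minus the
excess-pressure work `∫_s^{s+τ} ∫ (p − ρθ) div ψ` of the block fields, `p − ρθ = ρθ (Z(ρσ³) − 1)`. -/
def virialDefect (Φ : Flow σ N) (s τ : ℝ) (ψ : ℝ → T3 → V3) (z : Phase N) : ℝ :=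
  collisionalWork Φ s τ ψ z -
    ∫ r in s..(s + τ), ∫ x, (blockPressure Φ z r x - blockDensity Φ z r x * blockTemperature Φ z r x) *
      Literature.Analysis.FunctionSpaces.Torus.divergence (ψ r) x

/-- **Piece T — transport / block-smoothing residual** `T_N := D_N − K_N − V_N`.  Stated as the
residual so that the assembly carries no integrability side conditions (Bochner junk values);
on good orbits every integrand is integrable and the exact microscopic momentum balance turns `T_N`
into `∫_s^{s+τ} [(N+1)⁻¹ Σ_k ⟪Dψ(r,q_k) v_k, v_k⟫ − ∫_x Σ_ij ∂_iψ_j(r,x) S^{(ℓ)}_{ij}(r,x)] dr`,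
the raw-minus-mollified kinetic flux. -/
def transportResidual (Φ : Flow σ N) (s τ : ℝ) (ψ : ℝ → T3 → V3) (z : Phase N) : ℝ :=
  eulerDefect Φ s τ ψ z - anisotropyDefect Φ s τ ψ z - virialDefect Φ s τ ψ z

/-! ## The three stub statements -/

/-- **Statement T (deterministic).** For `σ > 0`, every flow family, `0 ≤ s`, `0 < τ`, every `ψ`
smooth on `[s,s+τ] × 𝕋³` and `δ > 0`: eventually in `N`, for every GOOD datum whose orbit obeys the
speed cap on `[s,s+τ]`, `|T_N| ≤ δ` (`T_N = O(ℓ_N ‖D²ψ‖_∞ (N+1)^{1/12} τ) = O(N^{-1/6})`). -/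
def BalanceOnBlockStress : Prop :=
  ∀ σ : ℝ, 0 < σ → ∀ Φ : (N : ℕ) → Flow σ N, ∀ (s τ : ℝ), 0 ≤ s → 0 < τ →
    ∀ ψ : ℝ → T3 → V3,
      Literature.Analysis.FunctionSpaces.Torus.IsSmoothSpaceTimeOn (Set.Icc s (s + τ)) ψ →
        ∀ δ : ℝ, 0 < δ → ∀ᶠ N : ℕ in Filter.atTop, ∀ z ∈ (Φ N).good,
          SpeedCapped (Φ N) s τ z → |transportResidual (Φ N) s τ ψ z| ≤ δ

/-- **Statement K (large deviations; load-bearing).** Same quantifier frame and caps as the crux,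
with the anisotropy work `K_N` in place of `D_N`. -/
def KineticIsotropyCost : Prop :=
  ∃ η₁ : ℝ, 0 < η₁ ∧ ∃ σ₀ : ℝ, 0 < σ₀ ∧ ∀ σ : ℝ, 0 < σ → σ < σ₀ → ∀ θe : ℝ, 0 < θe →
    ∀ Φ : (N : ℕ) → Flow σ N, ∀ (s τ : ℝ), 0 ≤ s → 0 < τ → ∀ ψ : ℝ → T3 → V3,
      Literature.Analysis.FunctionSpaces.Torus.IsSmoothSpaceTimeOn (Set.Icc s (s + τ)) ψ →
        ∀ δ : ℝ, 0 < δ → ∀ M : ℝ, ∀ᶠ N : ℕ in Filter.atTop,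
          localGibbsLaw σ (fun _ => 1) (fun _ => 0) (fun _ => θe) N (Φ N)
              {z | SpeedCapped (Φ N) s τ z ∧ PackingCapped η₁ (Φ N) s τ z ∧
                δ < |anisotropyDefect (Φ N) s τ ψ z|} ≤
            ENNReal.ofReal (Real.exp (-(M * (N + 1))))

/-- **Statement V (large deviations).** Same frame and caps, with the virial defect `V_N`. -/
def VirialClosureCost : Prop :=
  ∃ η₁ : ℝ, 0 < η₁ ∧ ∃ σ₀ : ℝ, 0 < σ₀ ∧ ∀ σ : ℝ, 0 < σ → σ < σ₀ → ∀ θe : ℝ, 0 < θe →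
    ∀ Φ : (N : ℕ) → Flow σ N, ∀ (s τ : ℝ), 0 ≤ s → 0 < τ → ∀ ψ : ℝ → T3 → V3,
      Literature.Analysis.FunctionSpaces.Torus.IsSmoothSpaceTimeOn (Set.Icc s (s + τ)) ψ →
        ∀ δ : ℝ, 0 < δ → ∀ M : ℝ, ∀ᶠ N : ℕ in Filter.atTop,
          localGibbsLaw σ (fun _ => 1) (fun _ => 0) (fun _ => θe) N (Φ N)
              {z | SpeedCapped (Φ N) s τ z ∧ PackingCapped η₁ (Φ N) s τ z ∧
                δ < |virialDefect (Φ N) s τ ψ z|} ≤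
            ENNReal.ofReal (Real.exp (-(M * (N + 1))))

/-! ## Registered stubs (`sorry` only here) -/

/-- **stub T: momentum balance closes on the block stress (deterministic smoothing lemma).**
Why plausibly true: on a good orbit the weak momentum balance with a time-dependent `C^∞` field is
exact (free flight: `d/dr ⟨ψ(r,q_k),v_k⟩ = ⟨∂_rψ,v_k⟩ + ⟨Dψ v_k,v_k⟩`; collisions: the pair jumps
summed in `collisionalWork` — time-sliced `HardSphereFlow.momentumObservable_sub_eq_torus'`), every
integrand is piecewise continuous and bounded (interval-integrable), and the only non-cancelling
term is raw-vs-mollified kinetic flux, `≤ 9 τ ℓ_N ‖D²ψ‖_∞ max_k |v_k|² ≤ 9τ‖D²ψ‖_∞ (N+1)^{-1/6}`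
under the speed cap (ball of radius `ℓ_N < 1/2` has volume `4πℓ³/3`, so the kernel averages).
Size L.  Leans on: `Literature.Analysis.FluidPDE.HardSphereFlow.momentumObservable_sub_eq_torus'`,
`IsHardSphereTrajectory.sub_eq_integral_add_collisionalTransfer`, `Torus.IsSmoothSpaceTimeOn`,
Spohn1991 Part I (3.3)/(3.7). -/
theorem stub_balanceOnBlockStress : BalanceOnBlockStress := by
  sorry

/-- **stub K: kinetic isotropy of the block stress is superexponentially sure (HARDEST).**
Why plausibly true / why it might fail: sustained anisotropic second moments in a DILUTE block relax
in one collision time `≍ N^{-1/3}` (linearised hard-sphere Boltzmann spectral gap on the stress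
mode), so upkeep over an `O(1)` window should cost `≍ N·N^{1/3}` in `G`-entropy (MFT cost rule,
BertiniEtAl2015; Kifer1990 / Young1990 linear-in-time LD costs) — but this is exactly where the
refuter's O(N) "vacuum-gap needle beam" witness (SUSPECT-FALSE-14424.md) lives: collisionless
counter-streaming sheets in an evacuated slab make `K_N = p_Z τ` at cost `≈ 2.3N`; if confirmed the
stub (and the crux as typed) is false and the repair adds a 4th-moment cap to `SpeedCapped`.
Size XL / open.  Leans on: KipnisLandim1999 Ch.10 Thm 3.1 (stochastic template), Spohn1991 §7,
BGSSAnnals2023 (L² framework), the invariant law `GibbsInvariance` (stmt-9239, proved). -/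
theorem stub_kineticIsotropyCost : KineticIsotropyCost := by
  sorry

/-- **stub V: the collisional momentum flux is the EOS excess pressure, superexponentially surely.**
Why plausibly true: contact configurations refresh every collision time `≍ N^{-1/3}`, an anomalous
contact value `g(σ⁺)` at one time already costs `O(N)` (extensive configurational entropy), so
sustaining `Σ_coll d_N⟨n̂·∇ψ·n̂⟩|Δv| ≠ ∫∫ ρθ(Z(ρσ³)−1) div ψ` over `[s,s+τ]` costs `≫ N`; sub-block
over-compressed clusters ("popcorn") deliver at most `O(n_c^{1/3} ℓ-capped · N^{-1/3} log(1/gap))`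
work per particle, `→ 0` under the packing cap; the cheapest known violation is macroscopic
collisionless lanes at normal density, `Θ(N log N)` (card collisionless-corners-log-price) — still
superexponential.  Why it might fail: the EOS branch `hsCompressibility = 1 + η f_ex'(η)` is a
`deriv` (junk `0` off differentiability) of a `limsup` free energy — needs the virial-radius
analyticity fact (LebowitzPenrose1964 / Ruelle1969 §4) as a hypothesis-level input.  Size XL / open.
Leans on: Spohn1991 Part I (3.15) (virial theorem), `Literature.Analysis.FluidPDE.collisionalStress`
/ `collisionalVirial_nonneg_torus`, Ruelle1969 §3.4, `hsCompressibility`. -/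
theorem stub_virialClosureCost : VirialClosureCost := by
  sorry

/-! ## Assembly (sorry-free) -/

/-- Local alias of the crux (definitionally, `Iff.rfl`), so that exactly ONE theorem of this file — the
registered `MomentumClosureCost_of` — has the crux decl as its syntactic head (`#h21_check_skeleton`
(i)/(ii): the crux-headed theorem may take no hypotheses but registered obligations). -/
def CruxStatement : Prop :=
  Summit.AtomisticToContinuum.HydrodynamicLimit.Theses.SuperextensiveClosureCost.MomentumClosureCost

/-- `CruxStatement` IS the crux. -/
theorem cruxStatement_iff :
    CruxStatement ↔
      Summit.AtomisticToContinuum.HydrodynamicLimit.Theses.SuperextensiveClosureCost.MomentumClosureCost :=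
  Iff.rfl


/-- **Composition (sorry-free): the three stub STATEMENTS imply the crux BY NAME.**  `η₁ := min η_K η_V`, `σ₀ := min σ_K σ_V`;
for the crux's data take the three eventualities at tolerance `δ/3` and exponent `M+1`; for such `N`
the crux's event (whose `let`-bound caps and defect ARE `SpeedCapped ∧ PackingCapped η₁ ∧
δ < |eulerDefect|` by `rfl`) is contained in `goodᶜ ∪ {caps_K ∧ δ/3 < |K_N|} ∪ {caps_V ∧ δ/3 < |V_N|}`
(pathwise `|D| ≤ |T| + |K| + |V|`, `|T| ≤ δ/3` on good capped data, packing caps descend to the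
minimum), `G_N(goodᶜ) = 0` because `localGibbsLaw` has a density w.r.t. the Liouville measure and
`HardSphereFlow.measure_compl_good`, and `0 + 2e^{−(M+1)(N+1)} ≤ e^{−M(N+1)}` since `2 ≤ e^{N+1}`. -/
theorem MomentumClosureCost_of_stubs :
    BalanceOnBlockStress → KineticIsotropyCost → VirialClosureCost → CruxStatement := by
  intro hT hK hV
  obtain ⟨ηK, hηK, σK, hσK, hK⟩ := hK
  obtain ⟨ηV, hηV, σV, hσV, hV⟩ := hV
  unfold CruxStatement
    Summit.AtomisticToContinuum.HydrodynamicLimit.Theses.SuperextensiveClosureCost.MomentumClosureCost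
  refine ⟨min ηK ηV, lt_min hηK hηV, min σK σV, lt_min hσK hσV, ?_⟩
  intro σ hσ hσlt θe hθe Φ s τ hs hτ ψ hψ δ hδ M
  have hδ3 : 0 < δ / 3 := by positivity
  have h1 := hT σ hσ Φ s τ hs hτ ψ hψ (δ / 3) hδ3
  have h2 := hK σ hσ (lt_of_lt_of_le hσlt (min_le_left _ _)) θe hθe Φ s τ hs hτ ψ hψ (δ / 3) hδ3
    (M + 1)
  have h3 := hV σ hσ (lt_of_lt_of_le hσlt (min_le_right _ _)) θe hθe Φ s τ hs hτ ψ hψ (δ / 3) hδ3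
    (M + 1)
  filter_upwards [h1, h2, h3] with N hN1 hN2 hN3
  -- the reference law does not see the bad set of the flow
  have hgood : localGibbsLaw σ (fun _ => 1) (fun _ => 0) (fun _ => θe) N (Φ N) ((Φ N).good)ᶜ = 0 := by
    simp only [localGibbsLaw, Literature.Analysis.FluidPDE.particleLaw]
    exact MeasureTheory.withDensity_absolutelyContinuous _ _ (Φ N).measure_compl_good
  -- numerics: 2·e^{-(M+1)(N+1)} ≤ e^{-M(N+1)}
  have hnum : ENNReal.ofReal (Real.exp (-((M + 1) * (N + 1)))) +
      ENNReal.ofReal (Real.exp (-((M + 1) * (N + 1)))) ≤ ENNReal.ofReal (Real.exp (-(M * (N + 1)))) := by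
    rw [← ENNReal.ofReal_add (Real.exp_nonneg _) (Real.exp_nonneg _)]
    refine ENNReal.ofReal_le_ofReal ?_
    have hN : (0 : ℝ) ≤ (N : ℝ) := Nat.cast_nonneg N
    have h2 : (2 : ℝ) ≤ Real.exp ((N : ℝ) + 1) := by
      have := Real.add_one_le_exp ((N : ℝ) + 1)
      linarith
    have hexp : Real.exp (-((M + 1) * (N + 1))) * Real.exp ((N : ℝ) + 1) =
        Real.exp (-(M * (N + 1))) := by
      rw [← Real.exp_add]; congr 1; ring
    calc Real.exp (-((M + 1) * (N + 1))) + Real.exp (-((M + 1) * (N + 1)))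
        = Real.exp (-((M + 1) * (N + 1))) * 2 := by ring
      _ ≤ Real.exp (-((M + 1) * (N + 1))) * Real.exp ((N : ℝ) + 1) :=
          mul_le_mul_of_nonneg_left h2 (Real.exp_nonneg _)
      _ = Real.exp (-(M * (N + 1))) := hexp
  -- inclusion of events + union bound
  calc _ ≤ localGibbsLaw σ (fun _ => 1) (fun _ => 0) (fun _ => θe) N (Φ N)
          (((Φ N).good)ᶜ ∪
            ({z | SpeedCapped (Φ N) s τ z ∧ PackingCapped ηK (Φ N) s τ z ∧
                δ / 3 < |anisotropyDefect (Φ N) s τ ψ z|} ∪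
             {z | SpeedCapped (Φ N) s τ z ∧ PackingCapped ηV (Φ N) s τ z ∧
                δ / 3 < |virialDefect (Φ N) s τ ψ z|})) := by
        refine measure_mono fun z hz => ?_
        have hz' : SpeedCapped (Φ N) s τ z ∧ PackingCapped (min ηK ηV) (Φ N) s τ z ∧
            δ < |eulerDefect (Φ N) s τ ψ z| := hz
        obtain ⟨hsp, hpk, hdef⟩ := hz'
        by_cases hg : z ∈ (Φ N).good
        · have hres : |transportResidual (Φ N) s τ ψ z| ≤ δ / 3 := hN1 z hg hsp
          have hsplit : eulerDefect (Φ N) s τ ψ z = transportResidual (Φ N) s τ ψ z +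
              anisotropyDefect (Φ N) s τ ψ z + virialDefect (Φ N) s τ ψ z := by
            simp only [transportResidual]; ring
          have htri : |eulerDefect (Φ N) s τ ψ z| ≤ |transportResidual (Φ N) s τ ψ z| +
              |anisotropyDefect (Φ N) s τ ψ z| + |virialDefect (Φ N) s τ ψ z| := by
            rw [hsplit]; exact abs_add_three _ _ _
          have hpkK : PackingCapped ηK (Φ N) s τ z := fun r hr x =>
            (hpk r hr x).trans (min_le_left _ _)
          have hpkV : PackingCapped ηV (Φ N) s τ z := fun r hr x =>
            (hpk r hr x).trans (min_le_right _ _)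
          by_cases hKbig : δ / 3 < |anisotropyDefect (Φ N) s τ ψ z|
          · exact Or.inr (Or.inl ⟨hsp, hpkK, hKbig⟩)
          · have hVbig : δ / 3 < |virialDefect (Φ N) s τ ψ z| := by
              have hK' : |anisotropyDefect (Φ N) s τ ψ z| ≤ δ / 3 := not_lt.mp hKbig
              by_contra hcon
              have hV' : |virialDefect (Φ N) s τ ψ z| ≤ δ / 3 := not_lt.mp hcon
              linarith
            exact Or.inr (Or.inr ⟨hsp, hpkV, hVbig⟩)
        · exact Or.inl hg
    _ ≤ localGibbsLaw σ (fun _ => 1) (fun _ => 0) (fun _ => θe) N (Φ N) ((Φ N).good)ᶜ +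
          (localGibbsLaw σ (fun _ => 1) (fun _ => 0) (fun _ => θe) N (Φ N)
              {z | SpeedCapped (Φ N) s τ z ∧ PackingCapped ηK (Φ N) s τ z ∧
                δ / 3 < |anisotropyDefect (Φ N) s τ ψ z|} +
            localGibbsLaw σ (fun _ => 1) (fun _ => 0) (fun _ => θe) N (Φ N)
              {z | SpeedCapped (Φ N) s τ z ∧ PackingCapped ηV (Φ N) s τ z ∧
                δ / 3 < |virialDefect (Φ N) s τ ψ z|}) :=
        (measure_union_le _ _).trans (add_le_add le_rfl (measure_union_le _ _))
    _ ≤ 0 + (ENNReal.ofReal (Real.exp (-((M + 1) * (N + 1)))) +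
          ENNReal.ofReal (Real.exp (-((M + 1) * (N + 1))))) := by
        rw [hgood]; exact add_le_add le_rfl (add_le_add hN2 hN3)
    _ ≤ ENNReal.ofReal (Real.exp (-(M * (N + 1)))) := by rw [zero_add]; exact hnum


/-- **THE skeleton theorem (registered form): the crux BY NAME from the three declared stubs.**
`ledger skeleton check` admits only named obligations / declared stubs as inputs of the crux-headed
theorem, so the `<stub statements> → crux` composition is `MomentumClosureCost_of_stubs` (real proof,
axioms propext / Classical.choice / Quot.sound) and this theorem instantiates it; `sorryAx` enters its
closure only through `stub_balanceOnBlockStress`, `stub_kineticIsotropyCost`, `stub_virialClosureCost`. -/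
theorem MomentumClosureCost_of :
    Summit.AtomisticToContinuum.HydrodynamicLimit.Theses.SuperextensiveClosureCost.MomentumClosureCost :=
  MomentumClosureCost_of_stubs stub_balanceOnBlockStress stub_kineticIsotropyCost stub_virialClosureCost

end

end Summit.AtomisticToContinuum.HydrodynamicLimit.Cruxes.MomentumClosureCost.Birth
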